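import Literature.Analysis.FluidPDE.KNSSTypeIRateMildProofs
import HarnessLib

/-!
# Covariance of the Oseen integral equation under linear isometries and the rotated zoom

Analysis/FluidPDE support file (everything proved; no definitions, no named facts).  The Oseen
(Koch–Nadirashvili–Seregin–Šverák) integral equation
`u(t) = e^{(t−s)Δ}u(s) − B¹ₛ(u,u)(t)` is covariant under the full symmetry group of the
Navier–Stokes equations.  The tree has the translations and the parabolic scaling
(`oseenDuhamel_smul_stPull`, `heatExtension_smul_stPull`, `oseen_smul_stPull`,
`KNSSTypeIRateMildProofs.lean`); this file adds the **linear isometries** `u ↦ L u(L⁻¹ ·)`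
(Majda–Bertozzi 2002, Prop. 1.1 (iii), rotation symmetry) and their composite with the scaling,
the **rotated zoom** `(𝒵u)(t, x) = c R⁻¹ u(c²t, c R x)` of rotated discretely self-similar
solutions (Chae–Wolf 2017, Def. 1.1):

* `oseenDuhamel_symm_conj_linearIsometryEquiv` —
  `B^ν_s(R⁻¹w₁(R·), R⁻¹w₂(R·))(t) = R⁻¹ B^ν_s(w₁,w₂)(t)(R·)` (the kernel is `O(E)`-equivariant,
  `K(τ, Lz)[La, Lb] = L K(τ, z)[a, b]`, since its closed Gaussian form only involves `‖z‖`, inner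
  products and the vectors `z, a, b`; then the change of variables `y = R⁻¹y'`);
* `heatExtension_conj_linearIsometryEquiv` — the same for the caloric extension;
* `heatExtension_zoom`, `oseenDuhamel_zoom`, `oseen_zoom` — the rotated zoom
  `x ↦ c R⁻¹ f(c² t, c R x)` transports the caloric term, the Duhamel term and the Oseen
  equation from the times `c²s < c²t` to `s < t`.

## Mathlib / tree search

Tree: `oseenKernel`, `oseenDuhamel(_apply)`, `oseenDuhamel_smul_stPull`,
`heatExtension_smul_stPull`, `stPull_apply`, `UnboundedOperators.heatExtension_apply`,
`UnboundedOperators.heatKernel`. Mathlib: `LinearIsometryEquiv.measurePreserving`,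
`MeasurePreserving.integral_comp`, `ContinuousLinearEquiv.integral_comp_comm`,
`LinearIsometryEquiv.inner_map_map`.

## References

* A. J. Majda, A. L. Bertozzi, *Vorticity and Incompressible Flow*, CUP 2002, §1.2,
  Prop. 1.1 (iii). [MajdaBertozziCUP2002]
* D. Chae, J. Wolf, *Existence of discretely self-similar solutions to the Navier–Stokes
  equations for initial value in `L²_loc(ℝ³)`*, 2017, Def. 1.1. [ChaeWolf2017]
* G. Koch, N. Nadirashvili, G. Seregin, V. Šverák, Acta Math. 203 (2009), §1 (1.2), §4 p. 8.
  [KochNadirashviliSereginSverak2009]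
-/

noncomputable section

open MeasureTheory Set Function Filter
open _root_.Topology
open scoped RealInnerProductSpace

namespace Literature.Analysis.FluidPDE

variable {E : Type*} [NormedAddCommGroup E] [InnerProductSpace ℝ E] [FiniteDimensional ℝ E]
  [MeasurableSpace E] [BorelSpace E]

/-! ### Linear isometries -/

/-- **The Duhamel term is `O(E)`-covariant** (rotated form): conjugating both fields by a linear
isometry `R`, `w ↦ R⁻¹ w(t, R ·)`, conjugates `B^ν_s(w₁, w₂)(t)`:
`B^ν_s(R⁻¹w₁(R·), R⁻¹w₂(R·))(t)(y) = R⁻¹ B^ν_s(w₁, w₂)(t)(R y)`.  The kernel is equivariant,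
`K(τ, Lz)[La, Lb] = L K(τ, z)[a, b]` (its closed Gaussian form only involves `‖z‖`, inner
products and the vectors `z, a, b`), and `y' = R⁻¹ y` is a measure-preserving change of
variables; no integrability is needed (Majda–Bertozzi 2002, Prop. 1.1 (iii)). [cite: MajdaBertozziCUP2002, §1.2 Prop. 1.1 (iii)] -/
theorem oseenDuhamel_symm_conj_linearIsometryEquiv (R : E ≃ₗᵢ[ℝ] E) (ν s : ℝ)
    (w₁ w₂ : ℝ → E → E) (t : ℝ) (y : E) :
    oseenDuhamel ν s (fun τ x => R.symm (w₁ τ (R x))) (fun τ x => R.symm (w₂ τ (R x))) t y =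
      R.symm (oseenDuhamel ν s w₁ w₂ t (R y)) := by
  set L : E ≃ₗᵢ[ℝ] E := R.symm with hL
  have hRL : ∀ x, R x = L.symm x := fun x => by rw [hL, LinearIsometryEquiv.symm_symm]
  -- equivariance of the kernel
  have hK : ∀ (τ : ℝ) (z a b : E), oseenKernel τ (L z) (L a) (L b) = L (oseenKernel τ z a b) := by
    intro τ z a b
    have hG : UnboundedOperators.heatKernel τ (L z) = UnboundedOperators.heatKernel τ z := by
      simp [UnboundedOperators.heatKernel, L.norm_map]
    have hA : oseenWeightA τ (L z) = oseenWeightA τ z := by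
      simp [oseenWeightA, UnboundedOperators.heatKernel, L.norm_map]
    have hB : oseenWeightB τ (L z) = oseenWeightB τ z := by
      simp [oseenWeightB, UnboundedOperators.heatKernel, L.norm_map]
    simp only [oseenKernel, hG, hA, hB, LinearIsometryEquiv.inner_map_map, map_add, map_sub,
      LinearIsometryEquiv.map_smul]
  simp only [hRL, oseenDuhamel_apply]
  have hmp : MeasurePreserving L volume volume := L.measurePreserving
  have hinner : ∀ τ : ℝ,
      ∫ x, oseenKernel (ν * (t - τ)) (y - x) (L (w₁ τ (L.symm x))) (L (w₂ τ (L.symm x))) =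
        L.toContinuousLinearEquiv
          (∫ x, oseenKernel (ν * (t - τ)) (L.symm y - x) (w₁ τ x) (w₂ τ x)) := by
    intro τ
    rw [← L.toContinuousLinearEquiv.integral_comp_comm,
      ← hmp.integral_comp L.toHomeomorph.measurableEmbedding
        (fun x => oseenKernel (ν * (t - τ)) (y - x) (L (w₁ τ (L.symm x))) (L (w₂ τ (L.symm x))))]
    congr 1
    funext x
    have hz : y - L x = L (L.symm y - x) := by rw [map_sub, L.apply_symm_apply]
    simp only [LinearIsometryEquiv.symm_apply_apply, hz, hK,
      LinearIsometryEquiv.coe_toContinuousLinearEquiv]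
  simp_rw [hinner]
  rw [L.toContinuousLinearEquiv.integral_comp_comm]
  rfl

variable {F : Type*} [NormedAddCommGroup F] [NormedSpace ℝ F]

/-- **The caloric extension is `O(E)`-covariant**: `e^{tΔ}(L f(L⁻¹ ·))(x) = L (e^{tΔ}f)(L⁻¹ x)`
(the heat kernel is radial and `L` preserves Lebesgue measure). [folklore] -/
theorem heatExtension_conj_linearIsometryEquiv (L : E ≃ₗᵢ[ℝ] E) (f : E → E) (t : ℝ) (x : E) :
    UnboundedOperators.heatExtension (fun y => L (f (L.symm y))) t x =
      L (UnboundedOperators.heatExtension f t (L.symm x)) := by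
  rw [UnboundedOperators.heatExtension_apply, UnboundedOperators.heatExtension_apply]
  have hmp : MeasurePreserving L volume volume := L.measurePreserving
  have key : ∫ y, UnboundedOperators.heatKernel t y • L (f (L.symm (x - y))) =
      L.toContinuousLinearEquiv
        (∫ y, UnboundedOperators.heatKernel t y • f (L.symm x - y)) := by
    rw [← L.toContinuousLinearEquiv.integral_comp_comm,
      ← hmp.integral_comp L.toHomeomorph.measurableEmbedding
        (fun y => UnboundedOperators.heatKernel t y • L (f (L.symm (x - y))))]
    congr 1
    funext y
    have hz : L.symm (x - L y) = L.symm x - y := by rw [map_sub, L.symm_apply_apply]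
    have hG : UnboundedOperators.heatKernel t (L y) = UnboundedOperators.heatKernel t y := by
      simp [UnboundedOperators.heatKernel, L.norm_map]
    simp only [hz, hG, LinearIsometryEquiv.coe_toContinuousLinearEquiv,
      LinearIsometryEquiv.map_smul]
  exact key

/-! ### The rotated zoom `(𝒵 f)(t, x) = c R⁻¹ f(c² t, c R x)` -/

/-- **The caloric term of a rotated-zoomed slice**: for `c, T > 0` and a linear isometry `R`,
`e^{TΔ}(c R⁻¹ g(c R ·))(y) = c R⁻¹ (e^{c²TΔ}g)(c R y)` (scaling covariance
`heatExtension_comp_smul` and isometry covariance). [folklore] -/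
theorem heatExtension_zoom {c : ℝ} (hc : 0 < c) (R : E ≃ₗᵢ[ℝ] E) (g : E → E) {T : ℝ} (hT : 0 < T)
    (y : E) :
    UnboundedOperators.heatExtension (fun x => c • R.symm (g (c • R x))) T y =
      c • R.symm (UnboundedOperators.heatExtension g (c ^ 2 * T) (c • R y)) := by
  have h1 : (fun x => c • R.symm (g (c • R x))) =
      fun x => R.symm ((fun z => c • g (c • z)) (R.symm.symm x)) := by
    funext x
    simp only [LinearIsometryEquiv.symm_symm, LinearIsometryEquiv.map_smul]
  rw [h1, heatExtension_conj_linearIsometryEquiv R.symm (fun z => c • g (c • z)) T y,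
    LinearIsometryEquiv.symm_symm, UnboundedOperators.heatExtension_const_smul,
    heatExtension_comp_smul hc g hT, LinearIsometryEquiv.map_smul]

/-- **The Duhamel term of a rotated-zoomed field**: for `c > 0`, a linear isometry `R`, and
`s ≤ t`, with `(𝒵f)(τ, x) = c R⁻¹ f(c²τ, c R x)`:
`B¹ₛ(𝒵f, 𝒵f)(t)(y) = c R⁻¹ B¹_{c²s}(f, f)(c²t)(c R y)` (the parabolic covariance
`oseenDuhamel_smul_stPull` and the isometry covariance; KNSS 2009, §1 (1.2);
Chae–Wolf 2017, Def. 1.1). [cite: KochNadirashviliSereginSverak2009, §1 (1.2) (arXiv p. 2)] -/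
theorem oseenDuhamel_zoom {c : ℝ} (hc : 0 < c) (R : E ≃ₗᵢ[ℝ] E) (f : ℝ → E → E) {s t : ℝ}
    (hst : s ≤ t) (y : E) :
    oseenDuhamel 1 s (fun τ x => c • R.symm (f (c ^ 2 * τ) (c • R x)))
        (fun τ x => c • R.symm (f (c ^ 2 * τ) (c • R x))) t y =
      c • R.symm (oseenDuhamel 1 (c ^ 2 * s) f f (c ^ 2 * t) (c • R y)) := by
  set w : ℝ → E → E := c • stPull (c ^ 2) c 0 0 f with hw
  have h1 : (fun τ x => c • R.symm (f (c ^ 2 * τ) (c • R x))) =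
      fun τ x => R.symm (w τ (R x)) := by
    funext τ x
    simp only [hw, Pi.smul_apply, stPull_apply, zero_add, LinearIsometryEquiv.map_smul]
  rw [h1, oseenDuhamel_symm_conj_linearIsometryEquiv R 1 s w w t y, hw,
    oseenDuhamel_smul_stPull hc 0 0 f hst (R y), zero_add, zero_add, zero_add,
    LinearIsometryEquiv.map_smul]

/-- **The Oseen integral equation is covariant under the rotated zoom.** If `f` satisfies
`f(c²t) = e^{(c²t − c²s)Δ}f(c²s) − B¹_{c²s}(f, f)(c²t)` pointwise (`s < t`, `c > 0`), then
`𝒵f`, `(𝒵f)(τ, x) = c R⁻¹ f(c²τ, c R x)`, satisfies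
`(𝒵f)(t) = e^{(t−s)Δ}(𝒵f)(s) − B¹ₛ(𝒵f, 𝒵f)(t)` pointwise (KNSS 2009, §1 (1.2) with
Majda–Bertozzi 2002, Prop. 1.1 (iii); Chae–Wolf 2017, Def. 1.1). [cite: KochNadirashviliSereginSverak2009, §1 (1.2) (arXiv p. 2)] -/
theorem oseen_zoom {c : ℝ} (hc : 0 < c) (R : E ≃ₗᵢ[ℝ] E) {f : ℝ → E → E} {s t : ℝ} (hst : s < t)
    (hf : ∀ X, f (c ^ 2 * t) X =
      UnboundedOperators.heatExtension (f (c ^ 2 * s)) (c ^ 2 * t - c ^ 2 * s) X -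
        oseenDuhamel 1 (c ^ 2 * s) f f (c ^ 2 * t) X) (y : E) :
    c • R.symm (f (c ^ 2 * t) (c • R y)) =
      UnboundedOperators.heatExtension (fun x => c • R.symm (f (c ^ 2 * s) (c • R x))) (t - s) y -
        oseenDuhamel 1 s (fun τ x => c • R.symm (f (c ^ 2 * τ) (c • R x)))
          (fun τ x => c • R.symm (f (c ^ 2 * τ) (c • R x))) t y := by
  rw [heatExtension_zoom hc R (f (c ^ 2 * s)) (sub_pos.2 hst), oseenDuhamel_zoom hc R f hst.le,
    ← smul_sub, ← map_sub, show c ^ 2 * (t - s) = c ^ 2 * t - c ^ 2 * s by ring, ← hf]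

end Literature.Analysis.FluidPDE

end
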